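import Summits.AtomisticToContinuum.Crystallization.Theorems.ChartedZeroExcessLayeredLatticeLiouvilleZZM
import Summits.AtomisticToContinuum.Crystallization.Theorems.ChartedZeroExcessLayeredLatticeLiouvilleZZI
import Summits.AtomisticToContinuum.Crystallization.Theorems.ChartedZeroExcessLayeredLatticeLiouvilleZZJ

/-!
# (B′.4a) rider ZZN — CONE PINS, bridges (c1a)+(c1b): the second-shell cover and cap transport

Lineage `stmt-AtomisticToContinuum-26636` (route ChartedPlanarOrder), lens-2 g81, cone-pin programme (B′) (critic row 1471 (C): (c1a) → (c1) → …).
Rider ZZI certifies, for every direction `w ≠ 0` and every letter context, a passing CELL `cs` (`pin_certificate`): the caps of all its members and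
allowed competitors hold against `w` as exact integer inequalities `capZB`.  Rider ZZM places the first shell and the ORTHOGONAL second shell of a
charted clean atom `a/16`-close to an isometric image `a • F (ι/√18)` of rider ZZH's integer embedding.  This file supplies the two bridges between them.

* §1 INDEX SIDE (`decide`).  The first shell of any context `letters4 a b c d` reads rider ZZK's table `iotaTab b c` (`iota_shell1_eq_iotaTab`); every
  SECOND-SHELL site `z ∈ shell2` is the two-step site of a pair of codes ORTHOGONAL in the centre's table, with `ι z = ιTab i + ιTab j`
  (`shell2_cover`) — exactly the pairs rider ZZM places; rider ZZL's letter congruence and translation move both to an arbitrary charted site `x`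
  (`linkPt_eq_add_letters4`, `linkPt_linkPt_eq_add_letters4`).
* §2 REAL SIDE.  A linear isometry `F` of `ℝ³` is onto, so a direction pulls back: `⟪F u, w⟫ = ⟪u, w'⟫`, `‖w'‖ = ‖w‖` (`exists_pullback`); a cap
  certified against `w'` becomes a cap of the framed vector against `w` (`inner_ge_transport`); whence the MEMBER CONES (`member_first_cone_of_cap`:
  cap `25/81 ↦ 5/9`, reach `17a/16`; `member_second_cone_of_cap`: cap `121/400 ↦ 11/20`, reach `3a/2`; the trigonometry is rider ZZE's).
* §3 ★ `cell_at_site`: at a charted atom `x` with its two shells in the chart domain, over a two-shell-clean set, for any `w ≠ 0`: ONE scale, ONE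
  frame, the pulled-back direction and a PASSING CELL whose first- and second-shell members are charted atoms `Ψ (x + m)` in the `60°`-cone of `w` at
  `Ψ x` within `17/16 · a` resp. `3/2 · a` — the member half of the pin step; the cell's cap guarantee is handed on for the competitor half (rider ZZO).

0 sorry; kernel `decide` only (no `native_decide`).  Nothing here compares frames or scales of different atoms.
-/

open scoped RealInnerProductSpace
open Literature.Geometry.DiscreteGeometry (intVec intVec_apply norm_intVec sqNormInt dotInt IsTwoShellGoodSet intVec_add)

namespace Summit.AtomisticToContinuum.Crystallization.Theorems.ChartedZeroExcessLayeredLatticeLiouville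

open Summit.AtomisticToContinuum.Crystallization.Theorems.ChartedPlanarOrderRigidityDoor (E3)

/-! ## ZZN-1  Index side: the first shell reads the table, the second shell is covered by orthogonal pairs -/

/-- the first shell of any letter context reads rider ZZK's table: only the two central letters matter. [this file, g81] -/
theorem iota_shell1_eq_iotaTab : ∀ (a b c d : Bool) (i : Fin 12),
    iota (letters4 a b c d) (linkPt (letters4 a b c d) 0 i) = iotaTab b c i := by
  decide

/-- ★ THE SECOND-SHELL COVER: every second-shell site of a letter context is the two-step site of a pair of codes ORTHOGONAL in the centre's
table, and its embedding is the sum of the two table vectors (kernel `decide` over `16` contexts × `144` list entries × `144` pairs). [this file, g81] -/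
theorem shell2_cover : ∀ (a b c d : Bool), ∀ z ∈ shell2 (letters4 a b c d), ∃ i j : Fin 12,
    dotInt (iotaTab b c i) (iotaTab b c j) = 0 ∧ linkPt (letters4 a b c d) (linkPt (letters4 a b c d) 0 i) j = z ∧
      iotaTab b c i + iotaTab b c j = iota (letters4 a b c d) z := by
  decide +kernel

/-- two-step sites from the origin read the letters on `{−2, …, 1}` only (rider ZZL `linkPt_letters_congr`, twice). [formal bookkeeping] -/
theorem linkPt_twoStep_congr {ℓ ℓ' : ℤ → Bool} (h : ∀ m : ℤ, -2 ≤ m → m ≤ 1 → ℓ m = ℓ' m) (i j : Fin 12) :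
    linkPt ℓ (linkPt ℓ 0 i) j = linkPt ℓ' (linkPt ℓ' 0 i) j := by
  have hn := shell1_fst ℓ (linkPt ℓ 0 i) (mem_shell1.2 ⟨i, rfl⟩)
  rw [← linkPt_letters_congr h 0 (by simp) (by simp) i]
  exact linkPt_letters_congr h _ hn.1 hn.2 j

/-- the chart's link of `x` is `x` translated by the first shell of its letter context. [formal bookkeeping] -/
theorem linkPt_eq_add_letters4 (τ : ℤ → Bool) (x : ℤ × ℤ × ℤ) (i : Fin 12) :
    linkPt τ x i = x + linkPt (letters4 (τ (x.1 - 2)) (τ (x.1 - 1)) (τ x.1) (τ (x.1 + 1))) 0 i := by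
  rw [linkPt_eq_add τ x i, linkPt_letters_congr (letters4_shift τ x) 0 (by simp) (by simp) i]

/-- the chart's two-step sites of `x` are `x` translated by the two-step sites of its letter context. [formal bookkeeping] -/
theorem linkPt_linkPt_eq_add_letters4 (τ : ℤ → Bool) (x : ℤ × ℤ × ℤ) (i j : Fin 12) :
    linkPt τ (linkPt τ x i) j = x + linkPt (letters4 (τ (x.1 - 2)) (τ (x.1 - 1)) (τ x.1) (τ (x.1 + 1)))
      (linkPt (letters4 (τ (x.1 - 2)) (τ (x.1 - 1)) (τ x.1) (τ (x.1 + 1))) 0 i) j := by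
  rw [linkPt_eq_add τ x i, linkPt_add, linkPt_twoStep_congr (letters4_shift τ x)]

/-! ## ZZN-2  Real side: pulling a direction back through the frame; member cones -/

/-- a linear isometry of `ℝ³` is onto, so a direction `w` pulls back through it: `⟪F u, w⟫ = ⟪u, w'⟫` with `‖w'‖ = ‖w‖`. [this file, g81] -/
theorem exists_pullback (F : E3 →ₗᵢ[ℝ] E3) (w : E3) : ∃ w' : E3, ‖w'‖ = ‖w‖ ∧ ∀ u : E3, ⟪F u, w⟫ = ⟪u, w'⟫ := by
  let Fe : E3 ≃ₗᵢ[ℝ] E3 := F.toLinearIsometryEquiv rfl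
  refine ⟨Fe.symm w, Fe.symm.norm_map w, fun u => ?_⟩
  have hu : F u = Fe u := rfl
  rw [hu]
  conv_lhs => rw [← Fe.apply_symm_apply w]
  exact Fe.inner_map_map u (Fe.symm w)

/-- CAP TRANSPORT: a cosine bound certified against the pulled-back direction `w'` is the same cosine bound for every non-negative multiple of the
framed vector against `w`. [this file, g81] -/
theorem inner_ge_transport {F : E3 →ₗᵢ[ℝ] E3} {w w' : E3} (hF : ∀ u : E3, ⟪F u, w⟫ = ⟪u, w'⟫) (hn : ‖w'‖ = ‖w‖)
    {c : ℝ} {V : E3} (h : c * (‖V‖ * ‖w'‖) ≤ ⟪V, w'⟫) {t : ℝ} (ht : 0 ≤ t) :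
    c * (‖t • F V‖ * ‖w‖) ≤ ⟪t • F V, w⟫ := by
  have h1 : c * (‖F V‖ * ‖w‖) ≤ ⟪F V, w⟫ := by rw [F.norm_map, hF, ← hn]; exact h
  exact inner_smul_ge_of_inner_ge ht h1

/-- the framed table vector: `a • F (ιᵢ/√18) = (a/√18) • F ιᵢ`. [formal bookkeeping] -/
theorem smul_frame_iotaPt (F : E3 →ₗᵢ[ℝ] E3) (a : ℝ) (α β : Bool) (i : Fin 12) :
    a • F (iotaPt α β i) = (a * (Real.sqrt 18)⁻¹) • F (intVec (iotaTab α β i)) := by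
  rw [iotaPt, F.map_smul, smul_smul]

/-- ★ FIRST-SHELL MEMBER CONE: a link atom `n` placed `a/16`-close to `p + a • F (ιᵢ/√18)` whose code passes the member cap `25/81` against the
pulled-back direction lies in the `60°`-cone of `w` at `p`, within `17a/16` (rider ZZE `member_cone_first` does the trigonometry). [this file, g81] -/
theorem member_first_cone_of_cap {F : E3 →ₗᵢ[ℝ] E3} {w w' : E3} (hF : ∀ u : E3, ⟪F u, w⟫ = ⟪u, w'⟫) (hn : ‖w'‖ = ‖w‖)
    {a : ℝ} (ha : 0 < a) {α β : Bool} {i : Fin 12}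
    (hcap : Real.sqrt ((25 : ℕ) / (81 : ℕ)) * (‖intVec (iotaTab α β i)‖ * ‖w'‖) ≤ ⟪intVec (iotaTab α β i), w'⟫)
    {p n : E3} (hd : dist n (p + a • F (iotaPt α β i)) ≤ 1 / 16 * a) :
    1 / 2 * (‖n - p‖ * ‖w‖) ≤ ⟪n - p, w⟫ ∧ dist n p ≤ 17 / 16 * a := by
  have hU : ‖a • F (iotaPt α β i)‖ = a := by
    rw [norm_smul, F.norm_map, norm_iotaPt, mul_one, Real.norm_of_nonneg ha.le]
  have hw : 5 / 9 * (‖a • F (iotaPt α β i)‖ * ‖w‖) ≤ ⟪a • F (iotaPt α β i), w⟫ := by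
    rw [sqrt_thresholds.1] at hcap
    rw [smul_frame_iotaPt]
    exact inner_ge_transport hF hn hcap (by positivity)
  refine ⟨member_cone_first ha hU hd hw, ?_⟩
  calc dist n p ≤ dist n (p + a • F (iotaPt α β i)) + dist (p + a • F (iotaPt α β i)) p := dist_triangle _ _ _
    _ ≤ 1 / 16 * a + a := add_le_add hd (by rw [dist_eq_norm, add_sub_cancel_left, hU])
    _ = 17 / 16 * a := by ring

/-- the framed second-shell vector of an ORTHOGONAL pair has squared length `2a²`, and `a • F (ιᵢ/√18 + ιⱼ/√18) = (a/√18) • F (ιᵢ + ιⱼ)`.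
[formal bookkeeping] -/
theorem frame_second_data (F : E3 →ₗᵢ[ℝ] E3) (a : ℝ) {α β : Bool} {i j : Fin 12} (horth : dotInt (iotaTab α β i) (iotaTab α β j) = 0) :
    ‖a • F (iotaPt α β i + iotaPt α β j)‖ ^ 2 = 2 * a ^ 2 ∧
      a • F (iotaPt α β i + iotaPt α β j) = (a * (Real.sqrt 18)⁻¹) • F (intVec (iotaTab α β i + iotaTab α β j)) := by
  have e0 : iotaPt α β i + iotaPt α β j = (Real.sqrt 18)⁻¹ • intVec (iotaTab α β i + iotaTab α β j) := by
    rw [iotaPt, iotaPt, intVec_add, smul_add]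
  have h36 : (sqNormInt (iotaTab α β i + iotaTab α β j) : ℝ) = 36 := by
    have e : sqNormInt (iotaTab α β i + iotaTab α β j) =
        dotInt (iotaTab α β i) (iotaTab α β i) + 2 * dotInt (iotaTab α β i) (iotaTab α β j) + dotInt (iotaTab α β j) (iotaTab α β j) := by
      simp only [sqNormInt, dotInt, Pi.add_apply]; ring
    rw [e, horth, dotInt_iotaTab_self, dotInt_iotaTab_self]; norm_num
  have hsq : ‖iotaPt α β i + iotaPt α β j‖ ^ 2 = 2 := by
    have h := norm_scaled_sq (N := 18) (by norm_num) (iotaTab α β i + iotaTab α β j)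
    rw [show ((18 : ℕ) : ℝ) = 18 from by norm_num, h36] at h
    rw [e0, h]; norm_num
  refine ⟨?_, ?_⟩
  · rw [norm_smul, F.norm_map, mul_pow, hsq, Real.norm_eq_abs, sq_abs]; ring
  · rw [e0, F.map_smul, smul_smul]

/-- ★ SECOND-SHELL MEMBER CONE: an atom placed `a/16`-close to `p + a • F (ιᵢ/√18 + ιⱼ/√18)` for an orthogonal pair whose sum passes the member cap
`121/400` against the pulled-back direction lies in the `60°`-cone of `w` at `p`, within `3a/2` (rider ZZE `member_cone_second`). [this file, g81] -/
theorem member_second_cone_of_cap {F : E3 →ₗᵢ[ℝ] E3} {w w' : E3} (hF : ∀ u : E3, ⟪F u, w⟫ = ⟪u, w'⟫) (hn : ‖w'‖ = ‖w‖)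
    {a : ℝ} (ha : 0 < a) {α β : Bool} {i j : Fin 12} (horth : dotInt (iotaTab α β i) (iotaTab α β j) = 0)
    (hcap : Real.sqrt ((121 : ℕ) / (400 : ℕ)) * (‖intVec (iotaTab α β i + iotaTab α β j)‖ * ‖w'‖) ≤
      ⟪intVec (iotaTab α β i + iotaTab α β j), w'⟫)
    {p n : E3} (hd : dist n (p + a • F (iotaPt α β i + iotaPt α β j)) ≤ 1 / 16 * a) :
    1 / 2 * (‖n - p‖ * ‖w‖) ≤ ⟪n - p, w⟫ ∧ dist n p ≤ 3 / 2 * a := by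
  obtain ⟨hU, e⟩ := frame_second_data F a horth
  have hw : 11 / 20 * (‖a • F (iotaPt α β i + iotaPt α β j)‖ * ‖w‖) ≤ ⟪a • F (iotaPt α β i + iotaPt α β j), w⟫ := by
    rw [sqrt_thresholds.2.1] at hcap
    rw [e]
    exact inner_ge_transport hF hn hcap (by positivity)
  refine ⟨member_cone_second ha hU hd hw, ?_⟩
  have hUle : ‖a • F (iotaPt α β i + iotaPt α β j)‖ ≤ 23 / 16 * a := by
    nlinarith [norm_nonneg (a • F (iotaPt α β i + iotaPt α β j)), hU, ha]
  calc dist n p ≤ dist n (p + a • F (iotaPt α β i + iotaPt α β j)) + dist (p + a • F (iotaPt α β i + iotaPt α β j)) p :=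
        dist_triangle _ _ _
    _ ≤ 1 / 16 * a + 23 / 16 * a := add_le_add hd (by rw [dist_eq_norm, add_sub_cancel_left]; exact hUle)
    _ = 3 / 2 * a := by ring

/-! ## ZZN-3  The member half of the pin step at a charted site -/

/-- ★★ **MEMBER CONES AT A CHARTED SITE.**  Let `Ψ, τ` be a Barlow bond chart of the two-shell-clean set `S` on `D`, containing `x`, its link and its
two-step sites, and let `w ≠ 0`.  Then there are ONE scale `a ∈ [9/10, 1]`, ONE frame `F`, the pulled-back direction `w'` (`‖w'‖ = ‖w‖`,
`⟪F u, w⟫ = ⟪u, w'⟫`) and a PASSING CELL `cs` of rider ZZI for the letter context of `x`, such that: the cell's cap guarantee holds against `w'`; the two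
shells sit in the frame (rider ZZM); every FIRST-SHELL MEMBER `m ∈ cellSigma1` is a link site, `x + m = linkPt τ x i`, whose atom lies in the `60°`-cone
of `w` at `Ψ x` within `17/16 · a`; and every SECOND-SHELL MEMBER `m' ∈ cellSigma2` is a two-step site, `x + m' = linkPt τ (linkPt τ x i) j`, whose atom
lies in the same cone within `3/2 · a`. [this file, g81] -/
theorem cell_at_site {S : Set E3} {D : Set (ℤ × ℤ × ℤ)} {Ψ : ℤ × ℤ × ℤ → E3} {τ : ℤ → Bool} {x : ℤ × ℤ × ℤ}
    (hΨ : IsBarlowBondChart S D Ψ τ) (hxD : x ∈ D) (hlD : ∀ i, linkPt τ x i ∈ D) (hl2D : ∀ i j, linkPt τ (linkPt τ x i) j ∈ D)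
    (hclean : ∀ p ∈ S, IsTwoShellGoodSet (1 / 16) (9 / 10) 1 S p) {w : E3} (hw : w ≠ 0) :
    ∃ (a : ℝ) (F : E3 →ₗᵢ[ℝ] E3) (w' : E3) (cs : List (Fin 3 → ℤ)),
      9 / 10 ≤ a ∧ a ≤ 1 ∧ ‖w'‖ = ‖w‖ ∧ (∀ u : E3, ⟪F u, w⟫ = ⟪u, w'⟫) ∧
      cellCheckB (τ (x.1 - 2)) (τ (x.1 - 1)) (τ x.1) (τ (x.1 + 1)) cs = true ∧
      (∀ (num den : ℕ) (v : Fin 3 → ℤ), 0 < den → (∀ c ∈ cs, capZB num den v c = true) →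
        Real.sqrt (num / den) * (‖intVec v‖ * ‖w'‖) ≤ ⟪intVec v, w'⟫) ∧
      (∀ i : Fin 12, dist (Ψ (linkPt τ x i)) (Ψ x + a • F (iotaPt (τ (x.1 - 1)) (τ x.1) i)) ≤ 1 / 16 * a) ∧
      (∀ i j : Fin 12, dotInt (iotaTab (τ (x.1 - 1)) (τ x.1) i) (iotaTab (τ (x.1 - 1)) (τ x.1) j) = 0 →
        dist (Ψ (linkPt τ (linkPt τ x i) j)) (Ψ x + a • F (iotaPt (τ (x.1 - 1)) (τ x.1) i + iotaPt (τ (x.1 - 1)) (τ x.1) j)) ≤ 1 / 16 * a) ∧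
      (∀ m ∈ cellSigma1 (letters4 (τ (x.1 - 2)) (τ (x.1 - 1)) (τ x.1) (τ (x.1 + 1))) cs, ∃ i : Fin 12, x + m = linkPt τ x i ∧
        1 / 2 * (‖Ψ (x + m) - Ψ x‖ * ‖w‖) ≤ ⟪Ψ (x + m) - Ψ x, w⟫ ∧ dist (Ψ (x + m)) (Ψ x) ≤ 17 / 16 * a) ∧
      (∀ m' ∈ cellSigma2 (letters4 (τ (x.1 - 2)) (τ (x.1 - 1)) (τ x.1) (τ (x.1 + 1))) cs, ∃ i j : Fin 12,
        x + m' = linkPt τ (linkPt τ x i) j ∧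
        1 / 2 * (‖Ψ (x + m') - Ψ x‖ * ‖w‖) ≤ ⟪Ψ (x + m') - Ψ x, w⟫ ∧ dist (Ψ (x + m')) (Ψ x) ≤ 3 / 2 * a) := by
  obtain ⟨a, ha, ha1, F, hF1, hF2⟩ := secondShell_frame hΨ hxD hlD hl2D hclean
  obtain ⟨w', hn, hFw⟩ := exists_pullback F w
  have hw' : w' ≠ 0 := fun h => hw (norm_eq_zero.1 (by rw [← hn, h, norm_zero]))
  obtain ⟨cs, hcell, hcap⟩ := pin_certificate (τ (x.1 - 2)) (τ (x.1 - 1)) (τ x.1) (τ (x.1 + 1)) hw'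
  have hapos : 0 < a := by linarith
  refine ⟨a, F, w', cs, ha, ha1, hn, hFw, hcell, hcap, hF1, hF2, fun m hm => ?_, fun m' hm' => ?_⟩
  · obtain ⟨hm1, hmc⟩ := mem_cellSigma1.1 hm
    obtain ⟨i, rfl⟩ := mem_shell1.1 hm1
    have e : x + linkPt (letters4 (τ (x.1 - 2)) (τ (x.1 - 1)) (τ x.1) (τ (x.1 + 1))) 0 i = linkPt τ x i :=
      (linkPt_eq_add_letters4 τ x i).symm
    have hc := hcap 25 81 _ (by norm_num) hmc
    rw [iota_shell1_eq_iotaTab] at hc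
    refine ⟨i, e, ?_⟩
    rw [e]
    exact member_first_cone_of_cap hFw hn hapos hc (hF1 i)
  · obtain ⟨hm2, hmc⟩ := mem_cellSigma2.1 hm'
    obtain ⟨i, j, horth, hz, hι⟩ := shell2_cover _ _ _ _ m' hm2
    have e : x + m' = linkPt τ (linkPt τ x i) j := by
      rw [← hz]; exact (linkPt_linkPt_eq_add_letters4 τ x i j).symm
    have hc := hcap 121 400 _ (by norm_num) hmc
    rw [← hι] at hc
    refine ⟨i, j, e, ?_⟩
    rw [e]
    exact member_second_cone_of_cap hFw hn hapos horth hc (hF2 i j horth)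

end Summit.AtomisticToContinuum.Crystallization.Theorems.ChartedZeroExcessLayeredLatticeLiouville
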